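import Summits.KontsevichZagierPeriods.KontsevichZagierPeriods.Theorems.LinRedNormalFormHoffmanSpanInKZFastChunks

/-!
# Crux `LinRedNormalForm.HoffmanSpanInKZ` (stmt-KontsevichZagierPeriods-15044), line `Sketch`:
# fast mod-`p` transcript checkers, LOW-FOOTPRINT variant `X` — derived rows and chunks

The kernel checks each chunk of a transcript inside ONE declaration, and what a single declaration may
consume is bounded (measured at weight `13`: a derived chunk citing `≈ 60k` vector entries, or `60`
double-shuffle rows, exceeds it; the chunks of `…FastCert` / `…FastChunks` rebuild a memory of all earlier
rows and decide equalities of functions `Fin N → Bool`, which dominates at `2032` rows).  This file keeps the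
row semantics of `LinRedNormalFormHoffmanSpanInKZFastCert` but changes the bookkeeping:
* citations are PACKED two-level references `i * 4096 + j` = row `j` of chunk `i` (for the chunk being checked,
  `j` counts backwards from the current row), fetched from the chunk list itself (`getX`, `citeX`) — no memory
  is rebuilt;
* the encoding round trips of generator words and Hoffman words are checked as equalities of LISTS
  (`codeOkL`), not of functions;
* the certified word codes and the coverage test use a binary TRIE on words (`CT`), not `List.contains` /
  `List.Mem` on lists of up to `2^(N-2)` codes.
Soundness is proved exactly as in `…FastCert` (`mem_spanP_of_drowOkX`, `good_of_dtableOkX`,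
`uP_mem_spanP_of_wrowOkX`, `good_of_wtableOkX`), assembled over chunks (`good_of_dchunks`, `good_of_wchunks`,
`cover_of_coverOkX`) into `edsCertificate_of_chunksX` through `edsCertificate_of_unitP`.

Sources: the reflection set-up of `LinRedNormalFormHoffmanSpanInKZFastCert` (this tree). [folklore]
-/

namespace Summit.KontsevichZagierPeriods.LinRedNormalForm.HoffmanSpanInKZ

open Literature.NumberTheory.Transcendental
open Summit.KontsevichZagierPeriods.MzvKernelInKZ.Negative
open Summit.KontsevichZagierPeriods.MzvKernelInKZ.TwoPosets
open Submodule

/-! ## Blocked lists (blocks of `32`) and two-level fetch -/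

/-- Push onto a blocked list (blocks of at most `32`; a new block when the last one is full). [folklore] -/
def pushG {α : Type} : List (List α) → α → List (List α)
  | [], v => [[v]]
  | [b], v => bif Nat.blt b.length 32 then [b ++ [v]] else [b, [v]]
  | b :: b' :: bs, v => b :: pushG (b' :: bs) v

/-- Push a list of elements, in order. [folklore] -/
def pushAllG {α : Type} (mem : List (List α)) (vs : List α) : List (List α) := vs.foldl pushG mem

/-- A property of all elements is kept by `pushG`. [folklore] -/
theorem forall_pushG {α : Type} (P : α → Prop) : ∀ (mem : List (List α)) (v : α),
    (∀ b ∈ mem, ∀ x ∈ b, P x) → P v → ∀ b ∈ pushG mem v, ∀ x ∈ b, P x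
  | [], v, _, hv => fun b hb x hx => by
    simp only [pushG, List.mem_singleton] at hb
    subst hb
    simp only [List.mem_singleton] at hx
    subst hx
    exact hv
  | [b], v, hm, hv => by
    unfold pushG
    cases Nat.blt b.length 32 <;> simp only [cond_true, cond_false] <;> intro b' hb' x hx
    · rcases List.mem_cons.1 hb' with rfl | hb'
      · exact hm _ (by simp) x hx
      · simp only [List.mem_singleton] at hb'
        subst hb'
        simp only [List.mem_singleton] at hx
        subst hx
        exact hv
    · simp only [List.mem_singleton] at hb'
      subst hb'
      rcases List.mem_append.1 hx with hx | hx
      · exact hm b (by simp) x hx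
      · simp only [List.mem_singleton] at hx
        subst hx
        exact hv
  | b :: b' :: bs, v, hm, hv => by
    intro c hc x hx
    rw [pushG] at hc
    rcases List.mem_cons.1 hc with rfl | hc
    · exact hm _ (by simp) x hx
    · exact forall_pushG P (b' :: bs) v (fun d hd => hm d (List.mem_cons_of_mem _ hd)) hv c hc x hx

/-- A property of all elements is kept by `pushAllG`. [folklore] -/
theorem forall_pushAllG {α : Type} (P : α → Prop) (mem : List (List α)) (vs : List α)
    (hm : ∀ b ∈ mem, ∀ x ∈ b, P x) (hvs : ∀ v ∈ vs, P v) : ∀ b ∈ pushAllG mem vs, ∀ x ∈ b, P x := by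
  induction vs generalizing mem with
  | nil => simpa [pushAllG] using hm
  | cons v vs ih =>
    rw [pushAllG, List.foldl_cons]
    exact ih (pushG mem v) (forall_pushG P mem v hm (hvs v (by simp))) fun w hw => hvs w (by simp [hw])

/-- Two-level fetch: row `j` of chunk `i` (chunks blocked by `32`); the empty combination if absent.
[folklore] -/
def getX (mem : List (List (List (List (ℕ × ℕ))))) (i j : ℕ) : List (ℕ × ℕ) :=
  ((mem.getD (i / 32) []).getD (i % 32) []).getD j []

/-- `List.getD` returns a member or the default. [folklore] -/
theorem getD_mem_or {α : Type} (l : List α) (i : ℕ) (d : α) : l.getD i d ∈ l ∨ l.getD i d = d := by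
  rw [List.getD_eq_getElem?_getD]
  cases h : l[i]? with
  | none => exact Or.inr (by simp)
  | some a => exact Or.inl (by simpa using List.mem_of_getElem? h)

/-- A fetched vector has any property shared by all stored vectors and the empty one. [folklore] -/
theorem getX_prop (P : List (ℕ × ℕ) → Prop) (mem : List (List (List (List (ℕ × ℕ))))) (h0 : P [])
    (hm : ∀ g ∈ mem, ∀ ch ∈ g, ∀ v ∈ ch, P v) (i j : ℕ) : P (getX mem i j) := by
  unfold getX
  rcases getD_mem_or mem (i / 32) [] with hg | hg
  · rcases getD_mem_or (mem.getD (i / 32) []) (i % 32) [] with hc | hc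
    · rcases getD_mem_or ((mem.getD (i / 32) []).getD (i % 32) []) j [] with hv | hv
      · exact hm _ hg _ hc _ hv
      · rw [hv]; exact h0
    · rw [hc]; simpa using h0
  · rw [hg]; simpa using h0

/-- Citation during the check of chunk `k`: packed reference `i * 4096 + j`; for `i = k` the row `j` rows
back in the current chunk (latest first in `cur`), else row `j` of the earlier chunk `i`. [folklore] -/
def citeX (k : ℕ) (mem : List (List (List (List (ℕ × ℕ))))) (cur : List (List (ℕ × ℕ))) (ref : ℕ) :
    List (ℕ × ℕ) :=
  bif ref / 4096 == k then cur.getD (ref % 4096) [] else getX mem (ref / 4096) (ref % 4096)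

/-- A cited vector has any property shared by all stored vectors and the empty one. [folklore] -/
theorem citeX_prop (P : List (ℕ × ℕ) → Prop) (k : ℕ) (mem : List (List (List (List (ℕ × ℕ)))))
    (cur : List (List (ℕ × ℕ))) (h0 : P []) (hm : ∀ g ∈ mem, ∀ ch ∈ g, ∀ v ∈ ch, P v) (hc : ∀ v ∈ cur, P v)
    (ref : ℕ) : P (citeX k mem cur ref) := by
  unfold citeX
  cases (ref / 4096 == k) <;> simp only [cond_true, cond_false]
  · exact getX_prop P mem h0 hm _ _
  · rcases getD_mem_or cur (ref % 4096) [] with h | h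
    · exact hc _ h
    · rw [h]; exact h0

section DSound

variable {p N : ℕ}

/-- Cited combinations realising in `spanP` sum into `spanP`. [folklore] -/
theorem sum_citesX_mem_spanP (get : ℕ → List (ℕ × ℕ)) (hget : ∀ r, evalC p N (get r) ∈ spanP p N)
    (f : ℕ → ZMod p) (L : List (ℕ × ℕ)) : (L.map fun q => f q.2 • evalC p N (get q.1)).sum ∈ spanP p N := by
  refine list_sum_mem fun x hx => ?_
  obtain ⟨q, _, rfl⟩ := List.mem_map.1 hx
  exact smul_mem _ _ (hget q.1)

end DSound

/-! ## Derived rows -/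

/-- Encoding round trip of the generator's words, checked as equalities of lists. [folklore] -/
def codeOkL (N : ℕ) (g : Gen) : Bool :=
  (g.fvecZ N).all fun q => decide (wordOfCode N (codeOfWord q.1) = q.1)

/-- The list round trip implies the function round trip of `codeOk`. [folklore] -/
theorem codeOk_of_codeOkL {N : ℕ} {g : Gen} (h : codeOkL N g = true) : codeOk N g = true := by
  simp only [codeOkL, codeOk, List.all_eq_true, decide_eq_true_eq] at h ⊢
  intro q hq
  rw [h q hq]

/-- Accumulator of a derived row with a general citation fetch. [folklore] -/
def DRowP.accX (p N : ℕ) (get : ℕ → List (ℕ × ℕ)) (d : DRowP) : List (ℕ × ℕ) :=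
  foldMergeC p get false d.L (foldInsC p (d.g.fvecC p N) (d.V.map fun q => (q.1, (p - q.2 % p) % p)))

/-- Derived-row checker with a general citation fetch and list round trips. [folklore] -/
def drowOkX (p N : ℕ) (get : ℕ → List (ℕ × ℕ)) (d : DRowP) : Bool :=
  d.g.ok N && admOk N (d.g.fvecZ N) && codeOkL N d.g && (d.accX p N get).isEmpty

section DSound

variable {p N : ℕ}

/-- **Soundness of one derived row** (for `0 < p`): if every cited vector realises in `spanP`, so does the
claimed vector. [folklore] -/
theorem mem_spanP_of_drowOkX (hp : 0 < p) (get : ℕ → List (ℕ × ℕ)) (hget : ∀ r, evalC p N (get r) ∈ spanP p N)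
    (d : DRowP) (h : drowOkX p N get d = true) : evalC p N (d.cvec p) ∈ spanP p N := by
  simp only [drowOkX, Bool.and_eq_true] at h
  obtain ⟨⟨⟨hg, ha⟩, hc⟩, hz⟩ := h
  have h0 := evalC_eq_zero_of_isEmpty (p := p) (N := N) hz
  rw [DRowP.accX, evalC_foldMergeC, evalC_foldInsC, evalC_negV hp, ← DRowP.cvec,
    evalC_fvecC hp d.g (codeOk_of_codeOkL hc)] at h0
  have h1 : evalC p N (d.cvec p) =
      (d.L.map fun q => ((citeC p false q.2 : ℕ) : ZMod p) • evalC p N (get q.1)).sum +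
        evalG (ZMod p) N (d.g.fvecP p N) := by
    rw [← sub_eq_zero, ← neg_eq_zero, ← h0]; abel
  rw [h1]
  exact add_mem (sum_citesX_mem_spanP get hget (fun n => ((citeC p false n : ℕ) : ZMod p)) d.L)
    (evalG_fvecP_mem_spanP d.g hg ha)

end DSound

/-- Derived-table checker of chunk `k`: the rows verified so far in this chunk are kept latest-first in `cur`.
[folklore] -/
def dtableOkX (p N k : ℕ) (mem : List (List (List (List (ℕ × ℕ))))) : List (List (ℕ × ℕ)) → List DRowP → Bool
  | _, [] => true
  | cur, d :: ds => drowOkX p N (citeX k mem cur) d && dtableOkX p N k mem (d.cvec p :: cur) ds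

section DSound

variable {p N : ℕ}

/-- **Soundness of the derived-table checker of a chunk.** [folklore] -/
theorem good_of_dtableOkX (hp : 0 < p) (k : ℕ) (mem : List (List (List (List (ℕ × ℕ)))))
    (hmem : ∀ g ∈ mem, ∀ ch ∈ g, ∀ v ∈ ch, evalC p N v ∈ spanP p N) :
    ∀ (ds : List DRowP) (cur : List (List (ℕ × ℕ))), (∀ v ∈ cur, evalC p N v ∈ spanP p N) →
      dtableOkX p N k mem cur ds = true → ∀ d ∈ ds, evalC p N (d.cvec p) ∈ spanP p N
  | [], _, _, _ => fun d hd => by simp at hd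
  | d :: ds, cur, hcur, h => by
    simp only [dtableOkX, Bool.and_eq_true] at h
    have hd : evalC p N (d.cvec p) ∈ spanP p N :=
      mem_spanP_of_drowOkX hp _ (citeX_prop (fun v => evalC p N v ∈ spanP p N) k mem cur
        (by simp [evalC_nil]) hmem hcur) d h.1
    intro d' hd'
    rcases List.mem_cons.1 hd' with rfl | hd'
    · exact hd
    · refine good_of_dtableOkX hp k mem hmem ds (d.cvec p :: cur) ?_ h.2 d' hd'
      intro v hv
      rcases List.mem_cons.1 hv with rfl | hv
      exacts [hd, hcur v hv]

end DSound

/-! ## Derived chunks -/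

/-- The two-level memory of the claimed vectors of the first `k` chunks (no rebuilding of rows: the chunk
lists themselves, blocked by `32`). [folklore] -/
def memX (p : ℕ) (chunks : List (List DRowP)) (k : ℕ) : List (List (List (List (ℕ × ℕ)))) :=
  pushAllG [] ((chunks.take k).map fun ch => ch.map (DRowP.cvec p))

/-- Chunk `k` of a chunked derived table checks against the chunks `< k`. [folklore] -/
def dchunkOkX (p N : ℕ) (chunks : List (List DRowP)) (k : ℕ) : Bool :=
  dtableOkX p N k (memX p chunks k) [] (chunks.getD k [])

section DSound

variable {p N : ℕ}

/-- **Soundness of the chunked derived table**: every claimed vector realises in `spanP`. [folklore] -/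
theorem good_of_dchunks (hp : 0 < p) (chunks : List (List DRowP))
    (h : ∀ k < chunks.length, dchunkOkX p N chunks k = true) :
    ∀ d ∈ chunks.flatten, evalC p N (d.cvec p) ∈ spanP p N := by
  have key : ∀ k, k ≤ chunks.length → ∀ ch ∈ chunks.take k, ∀ d ∈ ch, evalC p N (d.cvec p) ∈ spanP p N := by
    intro k
    induction k with
    | zero => intro _ ch hch; simp at hch
    | succ k ih =>
      intro hk ch hch
      have hk' : k < chunks.length := hk
      rw [List.take_succ_eq_append_getElem hk'] at hch
      rcases List.mem_append.1 hch with hch | hch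
      · exact ih hk'.le ch hch
      · simp only [List.mem_singleton] at hch
        subst hch
        have hc := h k hk'
        rw [dchunkOkX, List.getD_eq_getElem?_getD, List.getElem?_eq_getElem hk', Option.getD_some] at hc
        refine good_of_dtableOkX hp k (memX p chunks k) ?_ _ [] (fun v hv => by simp at hv) hc
        refine forall_pushAllG (fun ch : List (List (ℕ × ℕ)) => ∀ v ∈ ch, evalC p N v ∈ spanP p N) [] _
          (fun b hb => by simp at hb) ?_
        intro vs hvs v hv
        obtain ⟨ch', hch', rfl⟩ := List.mem_map.1 hvs
        obtain ⟨d, hd, rfl⟩ := List.mem_map.1 hv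
        exact ih hk'.le ch' hch' d hd
  intro d hd
  obtain ⟨ch, hch, hdch⟩ := List.mem_flatten.1 hd
  exact key chunks.length le_rfl ch (by simpa using hch) d hdch

end DSound

/-! ## The registered stub -/

/-- Soundness of the low-footprint derived-chunk checker, as a statement about this file's checkers (not a
published fact). -/
def FastCertXDerivedSound : Prop :=
  ∀ (p N : ℕ), 0 < p → ∀ chunks : List (List DRowP), (∀ k < chunks.length, dchunkOkX p N chunks k = true) →
    ∀ d ∈ chunks.flatten, evalC p N (d.cvec p) ∈ spanP p N

/-- **Registered stub `stub_fastCertXDerived`** of the skeleton of line `Sketch`. -/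
theorem stub_fastCertXDerived : FastCertXDerivedSound := fun _ _ hp chunks h => good_of_dchunks hp chunks h

/-! ## Smoke test (kernel), weight `4`, modulo `65521`: two derived chunks, packed citation `0 * 4096 + 0` -/

example : dchunkOkX 65521 4 [[⟨.F [2] [2], [], [(1, 65520), (3, 4)]⟩],
    [⟨.D [3], [(0, 49141)], [(1, 16381), (5, 65520)]⟩, ⟨.K [2, 1, 1], [], [(1, 65520), (7, 1)]⟩]] 1 = true := by
  decide +kernel

end Summit.KontsevichZagierPeriods.LinRedNormalForm.HoffmanSpanInKZ
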